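import Summits.CriticalPhenomena.PercolationContinuityZ3.Theorems.PercNonProliferationNonProliferationJumpContinuousSplit
import Summits.CriticalPhenomena.PercolationContinuityZ3.Theorems.FreeBoxSparse.Negative.OfContinuity
import HarnessLib

/-!
# STRATEGY CENSUS v3 (r1) — typed companion of the redirect strategist's additions
# (crux stmt-CriticalPhenomena-4445 `PercNonProliferation.FreeBoxSparse`, planner-cstrat-stmt-CriticalPhenomena-4445-r1-0, 2026-08-17)

Companion of `Cruxes/FreeBoxSparse/STRATEGY-CENSUS.md` v3 (block "v3 (r1)"). The v1/v2 companions
(`StrategyCensus.lean`, `StrategyCensusS1.lean`) stay authoritative for T1–T15, S1–S10, D1–D9, N1–N9.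
Everything here is PROVED (no `sorry`, no stub); it records, kernel-checked:

* §1 **Relative summit-strength** — the theorem the tribunal asked for. `S → C` is landed
  (`Negative.OfContinuity`); given the route's OTHER crux — indeed only its jump branch
  `JumpNonProliferation := 0 < θ(p_c) → NonProliferation` (sibling split file) — `C ↔ S`:
  `freeBoxSparse_iff_continuity_of_jumpNonProliferation`, `freeBoxSparse_iff_continuity_of_nonProliferation`.
  So on this route any proof of the crux is, modulo the sibling crux, a proof of the summit conjunct, and
  conversely; the crux has no route-internal slack.
* §2 **What `closes` actually consumes** — the bridge `B := JumpForcesProliferation`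
  (`0 < θ(p_c) → ∀ M, P_{p_c}(N_n ≤ M) → 0`): `C → B` (the landed density count, read per `(M, c)`),
  `B → NonProliferation → S` (two lines), `S → B` (vacuous); hence `S → C → B → (NP → S)` and, given NP,
  `B ↔ C ↔ S`. `B` is the retired card "jump-forces-proliferation" absorbed by the route; it is WEAKER than
  `C` exactly by "dusty foams" (in-box giants coexisting with unboundedly many thin crossers) and has no known
  sufficient condition other than `C` and the `X_B` family — a retarget `C ↦ B` is admissible for `closes`
  but buys nothing (census v3 D11).
* §3 **D12, the limit split** — `crux ⇐ ConvergentFA2 ∧ LiminfSparse` with its glue PROVED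
  (`freeBoxSparse_of_convergent_of_liminf`): existence of `lim_n FA₂(p_c,n)` (fails only in OSCILLATING foam
  worlds) and `liminf_n FA₂(p_c,n) = 0` (fails only in PERSISTENT foam worlds). Both pieces are implied by the
  crux, neither implies it, neither has a tool, and the persistent foam is the generic counter-world (census §3),
  so `LiminfSparse` is the crux in substance: recorded, not filed (D-0019).
-/

noncomputable section

open MeasureTheory Filter Topology
open scoped Classical
open Literature.Probability.Percolation Literature.Probability.LatticeModels
open Summit.CriticalPhenomena.PercolationContinuityZ3.Theses.PercNonProliferation

namespace Summit.CriticalPhenomena.PercolationContinuityZ3.Cruxes.FreeBoxSparse.StrategyCensusR1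

/-! ## §0 Vocabulary -/

/-- `θ(p_c(ℤ³))`. -/
abbrev θc : ℝ := theta (zdGraph 3) (0 : Site 3) (criticalProbI 3)

/-- `P_{p_c}` on `ℤ³` (bond). -/
abbrev μc : Measure (BondConfig (Site 3)) := bondPercolation (zdGraph 3) (criticalProbI 3)

/-- Free-box pair sum at `p_c`: `Σ_{x,y∈Λ_n} P_{p_c}(x ↔ y inside Λ_n)`. -/
def pairSum (n : ℕ) : ℝ := ∑ x ∈ box 3 n, ∑ y ∈ box 3 n, μc.real (openConnIn ↑(box 3 n) x y)

/-- `FA₂(p_c, n)`; the crux is `fa2 → 0`. -/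
def fa2 (n : ℕ) : ℝ := pairSum n / ((box 3 n).card : ℝ) ^ 2

theorem freeBoxSparse_iff_fa2 : FreeBoxSparse ↔ Tendsto fa2 atTop (𝓝 0) := Iff.rfl

theorem fa2_nonneg (n : ℕ) : 0 ≤ fa2 n := by
  unfold fa2 pairSum
  refine div_nonneg (Finset.sum_nonneg fun _ _ => Finset.sum_nonneg fun _ _ => measureReal_nonneg) ?_
  positivity

theorem θc_nonneg : 0 ≤ θc := by
  unfold θc theta
  exact measureReal_nonneg

/-- The event `N_n ≤ M` ("no `M+1` points of `Λ_n`, pairwise unjoined inside `Λ_{2n}`, each joined inside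
`Λ_{2n}` to `∂⁻Λ_{2n}`"), verbatim from the route file. -/
def fewSpanning (M n : ℕ) : Set (BondConfig (Site 3)) :=
  {ω | ¬ ∃ x : Fin (M + 1) → Site 3, (∀ i, x i ∈ box 3 n) ∧
    (∀ i, ∃ y ∈ innerBoundary (zdGraph 3) (box 3 (2 * n)), ω ∈ openConnIn ↑(box 3 (2 * n)) (x i) y) ∧
    ∀ i j, i ≠ j → ω ∉ openConnIn ↑(box 3 (2 * n)) (x i) (x j)}

/-- The sibling crux, restated through `fewSpanning` (definitional). -/
theorem nonProliferation_iff :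
    NonProliferation ↔ ∃ (M : ℕ) (c : ℝ), 0 < c ∧ ∃ᶠ n : ℕ in atTop, c ≤ μc.real (fewSpanning M n) :=
  Iff.rfl

/-! ## §1 Relative summit-strength: modulo the sibling crux, `C ↔ S` -/

/-- `S → C` (landed: `Negative.OfContinuity`). -/
theorem freeBoxSparse_of_continuity (h : _root_.PercolationContinuityZ3) : FreeBoxSparse := by
  by_contra hC
  exact Summit.CriticalPhenomena.PercolationContinuityZ3.Theorems.FreeBoxSparse.Negative.not_percolationContinuityZ3_of_not_freeBoxSparse
    hC h

/-- The jump branch of the sibling crux (sibling split file `…NonProliferationJumpContinuousSplit`). -/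
def JumpNonProliferation : Prop := 0 < θc → NonProliferation

/-- **Relative summit-strength.** Given only the jump branch of the sibling crux, the crux is EQUIVALENT to
the summit conjunct (→ : the route's landed `closes`, re-glued on the jump branch; ← : `Negative.OfContinuity`). -/
theorem freeBoxSparse_iff_continuity_of_jumpNonProliferation (hJ : JumpNonProliferation) :
    FreeBoxSparse ↔ _root_.PercolationContinuityZ3 :=
  ⟨fun hC =>
    Summit.CriticalPhenomena.PercolationContinuityZ3.Theorems.NonProliferation.continuity_of_freeBoxSparse_of_jump
      hC hJ,
    freeBoxSparse_of_continuity⟩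

/-- Same with the full sibling crux `NonProliferation` (stmt-CriticalPhenomena-4444). -/
theorem freeBoxSparse_iff_continuity_of_nonProliferation (hNP : NonProliferation) :
    FreeBoxSparse ↔ _root_.PercolationContinuityZ3 :=
  freeBoxSparse_iff_continuity_of_jumpNonProliferation fun _ => hNP

/-! ## §2 The bridge `closes` consumes: `B := jump ⇒ proliferation` (census v3 D11) -/

/-- `B`: a jump forces the number of annulus-spanning box-clusters to diverge in probability at EVERY level `M`. -/
def JumpForcesProliferation : Prop :=
  0 < θc → ∀ M : ℕ, Tendsto (fun n : ℕ => μc.real (fewSpanning M n)) atTop (𝓝 0)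

/-- **`C → B`**: the landed density count (`nonProlifAssembly_proof` with its two proved supports), read at
each level `M` and each `c > 0`. -/
theorem jumpForcesProliferation_of_freeBoxSparse (hC : FreeBoxSparse) : JumpForcesProliferation := by
  intro hθ M
  rw [tendsto_order]
  refine ⟨fun a ha => Eventually.of_forall fun n => lt_of_lt_of_le ha measureReal_nonneg, fun c hc => ?_⟩
  by_contra hne
  have hfreq : ∃ᶠ n : ℕ in atTop, c ≤ μc.real (fewSpanning M n) :=
    (not_eventually.1 hne).mono fun n hn => not_lt.1 hn
  have hNP : NonProliferation := ⟨M, c, hc, hfreq⟩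
  have hS : _root_.PercolationContinuityZ3 :=
    Summit.CriticalPhenomena.PercolationContinuityZ3.Theorems.nonProlifAssembly_proof
      Summit.CriticalPhenomena.PercolationContinuityZ3.Theorems.spanningPiecesCount_proof
      Summit.CriticalPhenomena.PercolationContinuityZ3.Theorems.densityWhp_proof hC hNP
  have h0 : θc = 0 := Literature.Probability.Percolation.percolationContinuityZ3_iff.1 hS
  exact absurd h0 (ne_of_gt hθ)

/-- **`B → NonProliferation → S`** (two lines: on a jump, `P(N_n ≤ M) → 0` contradicts `frequently ≥ c`). -/
theorem continuity_of_jumpForcesProliferation (hB : JumpForcesProliferation) (hNP : NonProliferation) :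
    _root_.PercolationContinuityZ3 := by
  by_cases h0 : θc = 0
  · exact Literature.Probability.Percolation.percolationContinuityZ3_iff.2 h0
  have hθ : 0 < θc := lt_of_le_of_ne θc_nonneg (Ne.symm h0)
  obtain ⟨M, c, hc, hfreq⟩ := hNP
  have hev : ∀ᶠ n : ℕ in atTop, μc.real (fewSpanning M n) < c := (hB hθ M).eventually (gt_mem_nhds hc)
  obtain ⟨n, hn1, hn2⟩ := (hfreq.and_eventually hev).exists
  exact absurd hn2 (not_lt.2 hn1)

/-- `S → B` (vacuously: no jump). -/
theorem jumpForcesProliferation_of_continuity (h : _root_.PercolationContinuityZ3) : JumpForcesProliferation :=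
  fun hθ => absurd (Literature.Probability.Percolation.percolationContinuityZ3_iff.1 h) (ne_of_gt hθ)

/-- Given the sibling crux, `B ↔ S` … -/
theorem jumpForcesProliferation_iff_continuity_of_nonProliferation (hNP : NonProliferation) :
    JumpForcesProliferation ↔ _root_.PercolationContinuityZ3 :=
  ⟨fun hB => continuity_of_jumpForcesProliferation hB hNP, jumpForcesProliferation_of_continuity⟩

/-- … and `B ↔ C`: the lattice `S → C → B → (NP → S)` collapses modulo NP. -/
theorem jumpForcesProliferation_iff_freeBoxSparse_of_nonProliferation (hNP : NonProliferation) :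
    JumpForcesProliferation ↔ FreeBoxSparse :=
  (jumpForcesProliferation_iff_continuity_of_nonProliferation hNP).trans
    (freeBoxSparse_iff_continuity_of_nonProliferation hNP).symm

/-! ## §3 D12 — the limit split `crux ⇐ ConvergentFA2 ∧ LiminfSparse`, glue proved -/

/-- `FA₂(p_c, ·)` has a limit (no oscillation between foamy and sparse scales). -/
def ConvergentFA2 : Prop := ∃ L : ℝ, Tendsto fa2 atTop (𝓝 L)

/-- `liminf_n FA₂(p_c, n) = 0`: sparse free boxes along SOME sequence of scales (v1 D2's weak half). -/
def LiminfSparse : Prop := ∀ ε : ℝ, 0 < ε → ∃ᶠ n : ℕ in atTop, fa2 n ≤ ε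

/-- The crux gives both pieces. -/
theorem convergent_of_freeBoxSparse (h : FreeBoxSparse) : ConvergentFA2 := ⟨0, h⟩

theorem liminfSparse_of_freeBoxSparse (h : FreeBoxSparse) : LiminfSparse := fun _ε hε =>
  ((freeBoxSparse_iff_fa2.1 h).eventually (Iic_mem_nhds hε)).frequently

/-- **Glue of D12**: a convergent sequence with `liminf = 0` tends to `0`. -/
theorem freeBoxSparse_of_convergent_of_liminf (hconv : ConvergentFA2) (hlim : LiminfSparse) : FreeBoxSparse := by
  obtain ⟨L, hL⟩ := hconv
  have hL0 : 0 ≤ L := ge_of_tendsto hL (Eventually.of_forall fa2_nonneg)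
  have hLle : ∀ ε : ℝ, 0 < ε → L ≤ ε := by
    intro ε hε
    by_contra hlt'
    have hlt : ε < L := not_le.1 hlt'
    have hev : ∀ᶠ n : ℕ in atTop, ε < fa2 n := hL.eventually (lt_mem_nhds hlt)
    obtain ⟨n, hn1, hn2⟩ := ((hlim ε hε).and_eventually hev).exists
    exact absurd hn2 (not_lt.2 hn1)
  have hL00 : L = 0 := by
    refine le_antisymm ?_ hL0
    by_contra hpos'
    have hpos : 0 < L := not_le.1 hpos'
    have := hLle (L / 2) (by linarith)
    linarith
  rw [freeBoxSparse_iff_fa2]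
  simpa [hL00] using hL

end Summit.CriticalPhenomena.PercolationContinuityZ3.Cruxes.FreeBoxSparse.StrategyCensusR1

end
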